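import Mathlib
import Literature.MathematicalPhysics.QuantumFieldTheory.MullerSchiemann1987.MS87HeatKernelGroup
import HarnessLib

/-!
# Müller–Schiemann, *Continuum limit of a hierarchical SU(2) lattice gauge theory in 4 dimensions*
# (CMP 110, 1987), PROPOSITION 1 and (2.13)–(2.15): the complexified central angle
# `θ²(u, z) = 4f(½{1 − u₀ cos z − u₃ sin z})`, the function `f` («defined by inversion of η = sin²(θ/2) as a
# holomorphic function of θ², i.e. θ² = 4f(η)»), its holomorphy, the inversion identity, and Proposition 1
# for the heat-kernel action — PROVED

statement-level skeleton of published theorems with citation tags; proofs where landed; nothing here is a claim about the Yang–Mills mass gap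

**Citation header (reproduction of PUBLISHED work).** V. F. Müller, J. Schiemann, *Continuum limit of a hierarchical
SU(2) lattice gauge theory in 4 dimensions*, Commun. Math. Phys. **110** (1987) 261–286, doi 10.1007/BF01207367
[MullerSchiemann1987], Sect. 2 pp. 264–265: Proposition 1 with (2.13), (2.14), (2.15), its proof (2.16)–(2.17), and
the Remark following it. The displays were READ ON PAGE IMAGES of the held Project Euclid scan
`paper:url-96df5da18d4c` (PDF page = journal page − 260) rendered by this seat
(`run/shared/lean/pub/lit-balaban/lit-balaban-p12/renders-cmp110ms/ms87-cmp110-pdfp004/005-journalp264/265-x3.png`);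
the scan's text layer garbles all of them. Ninth file of `MullerSchiemann1987/`; it imports `MS87HeatKernelGroup`
(`u0`, `u3`, `diagPhase`, `u0_diagPhase_mul` = (2.17), `gTildeHK` = g̃_HK, `centralAngle`) and through it
`MS87HeatKernelComplex` (`hC` = h on ℂ, `hC_eq_hTr_cos`). Lean lane of the lit-balaban YM LIT SWEEP CONTEXT row X1
(register level, zero weight for any token of that table): the model is the `d = 4` HIERARCHICAL `SU(2)` gauge
model, NOT lattice Yang–Mills. This file discharges the item «Prop. 1's θ(u, z) as a holomorphic branch,
(2.13)–(2.15)» of the NOT-claimed list of `MS87HeatKernelGroup` — for the heat-kernel action, and for `θ²`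
(not `θ`: as printed, «for notational convenience only we use θ, θ̌ instead of θ² and θ̌²», p.265).

**What the paper prints (verbatim from the page images).**
* p.264 L.28–31 and **Proposition 1**: *«The analytical properties can be further exploited. Parametrizing u ∈ SU(2)
  by u = u₀σ₀ + iu·σ with {u₀, u} ∈ S³, the unit matrix σ₀ and the Pauli matrices σ_k, k = 1, 2, 3, we arrive at the
  Proposition 1. For z ∈ ℂ, |z| < ¼, we have g̃⁽ⁿ⁾(u, z) = h⁽ⁿ⁾(θ) for u₀ > −½, = h⁽ⁿ⁾(π − θ̌) for u₀ < ½, where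
  θ² = θ²(u, z) = 4f(½{1 − u₀ cos z − u₃ sin z}), (2.13) θ̌² = θ̌²(u, z) = 4f(½{1 + u₀ cos z + u₃ sin z}), (2.14)
  are defined by inversion of η = sin²(θ/2) as a holomorphic function of θ², i.e. θ² = 4f(η). Hence, with |η| < 1,
  f(η) = η[₂F₁(½, ½; 3/2; η)]². (2.15) Moreover θ²(u, z) and θ̌²(u, z) are continuous in u and holomorphic in z
  in their respective domains.»*
* p.265, Remark: *«Due to (2.11), (2.12) h⁽ⁿ⁾(θ) and h⁽ⁿ⁾(π − θ̌) are even functions of θ and θ̌, respectively; for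
  notational convenience only we use θ, θ̌ instead of θ² and θ̌² [we take the main branch of the square root in
  (2.13), (2.14)].»*
* p.265, Proof of Proposition 1: *«Since the Gibbs factors are class functions, (2.2), we have for x ∈ ℝ,
  g̃⁽ⁿ⁾(u, x) = g⁽ⁿ⁾(e^{−ixσ₃}u) = g⁽ⁿ⁾(e^{−iθσ₃}) = h⁽ⁿ⁾(θ) (2.16) with the central angle θ and its complement
  θ̌ = π − θ given by cos θ = u₀ cos x + u₃ sin x = −cos θ̌. (2.17) This implies the claim of the proposition for
  z = x real, |x| < ¼. Since θ²(u, z) and θ̌²(u, z) are holomorphic in z, |z| < ¼, and h⁽ⁿ⁾(θ), h⁽ⁿ⁾(π − θ̌) entire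
  and real analytic in θ² and θ̌², respectively, existence and uniqueness of the analytic continuation to |z| < ¼
  conclude the proof.»*

**What is formalized here (kernel-checked, zero `sorry`, zero named facts).**
* §1–§2 **The function `f`.** `fC η = Σ_{n≥0} a_{n+1} η^{n+1}` with `a_{n+1} = c_n/(n+1)`, `c₀ = 1`,
  `c_{n+1} = c_n(2n+2)/(2n+3)` — closed forms `c_n = 4ⁿ(n!)²/(2n+1)!` (`cK_closed`), `a_m = 2^{2m−1}((m−1)!)²/(2m)!`
  (`fA_closed`): the Taylor coefficients of `arcsin²√η = η[₂F₁(½,½;3/2;η)]²` (2.15); `a₁, a₂, a₃ = 1, ⅓, 8/45`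
  (`fA_zero_one_two` — so `4f(c/2) = 2c + ⅓c² + (4/45)c³ + …`, the inversion of `c = 1 − cos z` used in Sect. 4);
  absolute convergence on `|η| < 1` (`summable_fC_term`, `0 < a_m ≤ 1`) and **holomorphy of `f` on the unit disc**
  (`hasDerivAt_fC`, `differentiableOn_fC`; termwise differentiation).
* §3 **«Inversion of η = sin²(θ/2)»: `f(sin²y) = y²` for real `|y| < π/2`** (`fC_sin_sq`), hence
  **`4f(½(1 − cos θ)) = θ²` for real `|θ| < π`** (`four_fC_half_one_sub_cos`). Proof (elementary, no hypergeometric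
  theory): with `k(x) = Σ c_n x^{2n+1}` and `g(x) = f(x²) = Σ a_{n+1}x^{2n+2}` on `(−1, 1)`: `g′ = 2k` and `k′` termwise
  (`hasDerivAt_gR`, `hasDerivAt_kR`); the recurrence of `c_n` IS the differential equation `(1 − x²)k′ − xk = 1`
  (`kR_ode`), which `arcsin x/√(1 − x²)` also solves (`hasDerivAt_kA`); first-order uniqueness
  (`((k − k_A)√(1 − x²))′ = 0`) gives `k = arcsin x/√(1 − x²)` (`kR_eq_kA`), then `g′ = (arcsin²)′`, `g(0) = 0` give
  `g = arcsin²` (`gR_eq_arcsin_sq`), and `arcsin(sin y) = y`.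
* §4 **The inversion on the complex disc.** With `C(w) = Σ(−1)ⁿwⁿ/(2n)!` (entire, `cos θ = C(θ²)`: `cos_eq_cosSq`,
  `differentiable_cosSq`): **`C(4f(η)) = 1 − 2η` for all complex `|η| < 1`** (`cosSq_four_fC` — identity theorem on the
  disc from the real points `η = sin²t`), i.e. **`|η| < 1`, `θ² = 4f(η)` ⇒ `cos θ = 1 − 2η`** (`cos_eq_one_sub_two_mul`) —
  `η = sin²(θ/2)`, for either square root.
* §5 **(2.13), (2.14) and Proposition 1 for the heat-kernel action.** `η(u, z) = ½{1 − u₀ cos z − u₃ sin z}` (`etaOf`),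
  **`θ²(u, z) := 4f(η(u, z))`** (`thetaSq`, (2.13)), `θ̌²(u, z) := 4f(½{1 + u₀ cos z + u₃ sin z})` (`thetaCheckSq`, (2.14));
  «holomorphic in z in their respective domains» (`differentiableOn_thetaSq`, `differentiableOn_thetaCheckSq`, domains
  `{z : |η| < 1}`), «continuous in u» (`continuousOn_thetaSq`); **Proposition 1 (heat-kernel action): if `|η(u, z)| < 1`
  and `θ² = θ²(u, z)` then `g̃_HK(u, z) = h(θ)`** (`prop1_heatKernel`; any square root — `h` is even), second case
  `g̃_HK(u, z) = h(π − θ̌)` for `θ̌² = θ̌²(u, z)`, `|η̌| < 1` (`prop1_heatKernel_check`); the printed domain: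
  **`|z| < ¼`, `u₀ > −½` ⇒ `|η(u, z)| < 1`** (`norm_etaOf_lt_one`, crude bounds `|cos z − 1| ≤ 1/16`, `|sin z| ≤ 13/50`),
  so `prop1_heatKernel_of_small` / `prop1_heatKernel_check_of_small` (`|z| < ¼`, `u₀ < ½` ⇒ `|η̌| < 1`,
  `norm_etaCheckOf_lt_one`) are Proposition 1's two cases exactly as printed (for `g̃ = g̃_HK`); and (2.13) on the
  real slice IS the squared central angle: `θ²(u, x) = θ(e^{−ixσ₃}u)²` whenever `u₀(e^{−ixσ₃}u) > −1`
  (`thetaSq_ofReal`, via (2.17) `u0_diagPhase_mul`).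

* **(v1.1, §6) THE REMARK AFTER PROPOSITION 1, branch-free: `|Im θ| ≤ |Im z|` for every `θ` with
  `cos θ = u₀ cos z + u₃ sin z`, `u₀² + u₃² ≤ 1`** (`abs_im_le_of_cos_eq` — the printed ellipse argument: `u₀ cos z + u₃ sin z`
  lies inside the `|Im z|`-ellipse `(Re ω/cosh t)² + (Im ω/sinh t)² ≤ 1`, `cos θ` on the `|Im θ|`-one), hence for
  `θ² = θ²(u, z)` and for `θ̌² = θ̌²(u, z)` (`abs_im_le_of_thetaSq`, `abs_im_le_of_thetaCheckSq`).

**History.** v1.0 (lit-balaban-p12 gen 19, p349108): §1–§5. v1.1 (same seat): + §6 and the two `abs_im_le_of_theta…`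
corollaries in §5, append-only (no v1.0 declaration touched).

**Readings (declared).** (a) `f` is DEFINED by its Taylor series (the coefficients of `arcsin²√η`); the hypergeometric
form (2.15) is quoted, not formalized (Mathlib has no `₂F₁`); what (2.15) is used for — `f` holomorphic on `|η| < 1`
and `θ² = 4f(sin²(θ/2))` — is proved. (b) Proposition 1 is proved for the heat-kernel continued Gibbs factor
`g̃_HK` of `MS87HeatKernelGroup` (where `g̃_HK(u, z) = hTr(u₀ cos z + u₃ sin z)` is entire in `z` by construction);
for a general inductively continued `g̃⁽ⁿ⁾` ((2.7), defined in (I)) the object itself is not constructed in the tree.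
(c) `θ` itself (the «main branch of the square root») is not introduced — only `θ²`, as the paper's Remark allows;
`prop1_heatKernel` holds for either root. (d) The domains `{|η| < 1}`, `{|η̌| < 1}` are where `f`'s series converges; the printed sufficient conditions
`|z| < ¼` with `u₀ > −½` resp. `u₀ < ½` are proved to imply them (`norm_etaOf_lt_one`, `norm_etaCheckOf_lt_one`).

**Not claimed.** The Remark's `0 ≤ Re θ(u, z) < (5/6)π` (a statement about the chosen branch), the sets `𝒢[z, ρ]`
(2.18) and (2.19), (A₂), Theorem 1, anything about lattice Yang–Mills.
-/

noncomputable section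

open Real Filter Topology Set

namespace Literature.MathematicalPhysics.QuantumFieldTheory

namespace MullerSchiemann1987

namespace CentralAngle

/-! ### §1. The coefficients: `k(x) = arcsin x/√(1 − x²) = Σ c_n x^{2n+1}`, `f(η) = Σ_{n≥0} (c_n/(n+1)) η^{n+1}` -/

/-- `c_n`: `c₀ = 1`, `c_{n+1} = c_n (2n + 2)/(2n + 3)` (`= 4ⁿ(n!)²/(2n+1)!`, `cK_closed`), the Taylor coefficients of
`arcsin x/√(1 − x²) = Σ c_n x^{2n+1}`. [cite: MullerSchiemann1987, (2.15) p.265] -/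
def cK : ℕ → ℝ
  | 0 => 1
  | n + 1 => cK n * ((2 * n + 2) / (2 * n + 3))

/-- `c₀ = 1`. [cite: MullerSchiemann1987, (2.15) p.265] -/
@[simp] theorem cK_zero : cK 0 = 1 := rfl

/-- The recurrence `c_{n+1} = c_n (2n+2)/(2n+3)`. [cite: MullerSchiemann1987, (2.15) p.265] -/
theorem cK_succ (n : ℕ) : cK (n + 1) = cK n * ((2 * n + 2) / (2 * n + 3)) := rfl

/-- The recurrence, cleared of denominators: `(2n+3) c_{n+1} = (2n+2) c_n`. [cite: MullerSchiemann1987, (2.15) p.265] -/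
theorem cK_succ_mul (n : ℕ) : (2 * n + 3) * cK (n + 1) = (2 * n + 2) * cK n := by
  rw [cK_succ]; field_simp

/-- `c_n > 0`. [cite: MullerSchiemann1987, (2.15) p.265] -/
theorem cK_pos : ∀ n, 0 < cK n
  | 0 => by simp
  | n + 1 => by rw [cK_succ]; exact mul_pos (cK_pos n) (by positivity)

/-- `c_n ≤ 1` (the sequence decreases from `c₀ = 1`). [cite: MullerSchiemann1987, (2.15) p.265] -/
theorem cK_le_one : ∀ n, cK n ≤ 1
  | 0 => by simp
  | n + 1 => by
    rw [cK_succ]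
    have h1 : (2 * (n : ℝ) + 2) / (2 * n + 3) ≤ 1 := by rw [div_le_one (by positivity)]; linarith
    calc cK n * ((2 * n + 2) / (2 * n + 3)) ≤ 1 * 1 :=
          mul_le_mul (cK_le_one n) h1 (by positivity) zero_le_one
      _ = 1 := one_mul _

/-- Closed form `c_n = 4ⁿ(n!)²/(2n+1)!`. [cite: MullerSchiemann1987, (2.15) p.265] -/
theorem cK_closed : ∀ n, cK n = 4 ^ n * (n.factorial : ℝ) ^ 2 / ((2 * n + 1).factorial : ℝ)
  | 0 => by simp
  | n + 1 => by
    rw [cK_succ, cK_closed n]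
    have e1 : ((2 * (n + 1) + 1).factorial : ℝ) = (2 * n + 3) * (2 * n + 2) * ((2 * n + 1).factorial : ℝ) := by
      rw [show 2 * (n + 1) + 1 = (2 * n + 2) + 1 by ring, Nat.factorial_succ, Nat.factorial_succ (2 * n + 1)]
      push_cast; ring
    have e2 : ((n + 1).factorial : ℝ) = (n + 1) * (n.factorial : ℝ) := by
      rw [Nat.factorial_succ]; push_cast; ring
    rw [e1, e2]
    have hf : (0 : ℝ) < (2 * n + 1).factorial := by positivity
    field_simp
    ring

/-- `a_{n+1} = c_n/(n+1)`: the coefficient of `η^{n+1}` in `f` (`= 2^{2n+1}(n!)²/(2n+2)!`, `fA_closed`; these are the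
Taylor coefficients of `arcsin²√η = η[₂F₁(½, ½; 3/2; η)]²`, (2.15)). [cite: MullerSchiemann1987, (2.15) p.265] -/
def fA (n : ℕ) : ℝ := cK n / (n + 1)

/-- `a_{n+1} > 0`. [cite: MullerSchiemann1987, (2.15) p.265] -/
theorem fA_pos (n : ℕ) : 0 < fA n := div_pos (cK_pos n) (by positivity)

/-- `a_{n+1} ≤ 1`. [cite: MullerSchiemann1987, (2.15) p.265] -/
theorem fA_le_one (n : ℕ) : fA n ≤ 1 := by
  rw [fA, div_le_one (by positivity)]
  have := cK_le_one n
  have : (0 : ℝ) ≤ n := n.cast_nonneg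
  linarith

/-- Closed form `a_{n+1} = 2^{2n+1}(n!)²/(2n+2)!` (i.e. `a_m = 2^{2m−1}((m−1)!)²/(2m)!`). [cite: MullerSchiemann1987, (2.15) p.265] -/
theorem fA_closed (n : ℕ) : fA n = 2 ^ (2 * n + 1) * (n.factorial : ℝ) ^ 2 / ((2 * n + 2).factorial : ℝ) := by
  rw [fA, cK_closed]
  have e1 : ((2 * n + 2).factorial : ℝ) = (2 * n + 2) * ((2 * n + 1).factorial : ℝ) := by
    rw [Nat.factorial_succ (2 * n + 1)]; push_cast; ring
  have e2 : (2 : ℝ) ^ (2 * n + 1) = 2 * 4 ^ n := by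
    rw [pow_succ, pow_mul]; norm_num; ring
  rw [e1, e2]
  have hf : (0 : ℝ) < (2 * n + 1).factorial := by positivity
  field_simp

/-- The first coefficients: `a₁ = 1`, `a₂ = 1/3`, `a₃ = 8/45` — so `4f(c/2) = 2c + c²/3 + (4/45)c³ + …`, the series
inverting `c = 1 − cos z` used in Sect. 4 (cf. `MS87TwoLoopCoefficients.zsq_eq`). [cite: MullerSchiemann1987, (2.15) p.265, (4.14) p.270] -/
theorem fA_zero_one_two : fA 0 = 1 ∧ fA 1 = 1 / 3 ∧ fA 2 = 8 / 45 := by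
  refine ⟨?_, ?_, ?_⟩ <;> simp [fA, cK_succ] <;> norm_num

/-! ### §2. `f` on the complex unit disc: definition, convergence, holomorphy -/

/-- **The function `f` of (2.13)–(2.15)**: `f(η) = Σ_{n≥0} a_{n+1} η^{n+1}` (`= arcsin²√η = η[₂F₁(½,½;3/2;η)]²` for
`|η| < 1`; the identity `f(sin²(θ/2)) = θ²/4` is `fC_sin_sq_half` below). [cite: MullerSchiemann1987, (2.13)–(2.15) pp.264–265] -/
def fC (η : ℂ) : ℂ := ∑' n : ℕ, (fA n : ℂ) * η ^ (n + 1)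

/-- The terms of `f` are dominated by the geometric series: `‖a_{n+1} η^{n+1}‖ ≤ ‖η‖^{n+1}`. [cite: MullerSchiemann1987, (2.15) p.265] -/
theorem norm_fC_term_le (η : ℂ) (n : ℕ) : ‖(fA n : ℂ) * η ^ (n + 1)‖ ≤ ‖η‖ ^ (n + 1) := by
  rw [norm_mul, norm_pow, Complex.norm_real, Real.norm_eq_abs, abs_of_pos (fA_pos n)]
  exact mul_le_of_le_one_left (by positivity) (fA_le_one n)

/-- The series of `f` converges absolutely on the open unit disc. [cite: MullerSchiemann1987, (2.15) p.265] -/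
theorem summable_fC_term {η : ℂ} (hη : ‖η‖ < 1) : Summable fun n : ℕ => (fA n : ℂ) * η ^ (n + 1) := by
  refine Summable.of_norm_bounded (g := fun n => ‖η‖ ^ (n + 1)) ?_ (norm_fC_term_le η)
  exact (summable_geometric_of_lt_one (norm_nonneg _) hη).comp_injective (add_left_injective 1)

/-- `f(0) = 0`. [cite: MullerSchiemann1987, (2.13) p.264] -/
theorem fC_zero : fC 0 = 0 := by simp [fC]

/-- **`f` is holomorphic on the unit disc** («a holomorphic function of θ²», p.264; termwise differentiation with the
summable majorant `(n+1) rⁿ` on each smaller disc). [cite: MullerSchiemann1987, Prop. 1 p.264, (2.15) p.265] -/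
theorem hasDerivAt_fC {η : ℂ} (hη : ‖η‖ < 1) :
    HasDerivAt fC (∑' n : ℕ, (fA n : ℂ) * ((n + 1 : ℕ) * η ^ n)) η := by
  obtain ⟨r, hηr, hr1⟩ := exists_between hη
  have hr0 : 0 < r := (norm_nonneg _).trans_lt hηr
  have hu : Summable fun n : ℕ => ((n : ℝ) + 1) * r ^ n := by
    have h1 : Summable fun n : ℕ => (n : ℝ) ^ 1 * r ^ n :=
      summable_pow_mul_geometric_of_norm_lt_one 1 (by rw [Real.norm_eq_abs, abs_of_pos hr0]; exact hr1)
    simpa [add_mul] using h1.add (summable_geometric_of_lt_one hr0.le hr1)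
  refine hasDerivAt_tsum_of_isPreconnected (t := Metric.ball (0 : ℂ) r) (g := fun n z => (fA n : ℂ) * z ^ (n + 1))
    (g' := fun n z => (fA n : ℂ) * ((n + 1 : ℕ) * z ^ n)) hu Metric.isOpen_ball
    (convex_ball _ _).isPreconnected (fun n z _ => ?_) (fun n z hz => ?_) (Metric.mem_ball_self hr0)
    (summable_fC_term (by simp)) (by simpa using hηr)
  · exact ((hasDerivAt_pow (n + 1) z).const_mul _).congr_deriv (by push_cast; ring)
  · rw [Metric.mem_ball, dist_zero_right] at hz
    rw [norm_mul, norm_mul, norm_pow, Complex.norm_real, Real.norm_eq_abs, abs_of_pos (fA_pos n),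
      Complex.norm_natCast]
    push_cast
    calc fA n * ((n + 1) * ‖z‖ ^ n) ≤ 1 * ((n + 1) * r ^ n) := by
          gcongr
          · exact fA_le_one n
      _ = (n + 1) * r ^ n := one_mul _

/-- `f` is complex-differentiable on the open unit disc. [cite: MullerSchiemann1987, Prop. 1 p.264] -/
theorem differentiableOn_fC : DifferentiableOn ℂ fC (Metric.ball 0 1) := fun η hη =>
  (hasDerivAt_fC (by simpa using hη)).differentiableAt.differentiableWithinAt

/-! ### §3. The real identity `f(sin²y) = y²`: `f` inverts `η = sin²(θ/2)` -/

/-- `k(x) = Σ c_n x^{2n+1}` (will be `arcsin x/√(1−x²)`). [cite: MullerSchiemann1987, (2.15) p.265] -/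
def kR (x : ℝ) : ℝ := ∑' n : ℕ, cK n * x ^ (2 * n + 1)

/-- `k′(x) = Σ (2n+1) c_n x^{2n}` (termwise derivative). [cite: MullerSchiemann1987, (2.15) p.265] -/
def kR' (x : ℝ) : ℝ := ∑' n : ℕ, (2 * n + 1) * cK n * x ^ (2 * n)

/-- `g(x) = f(x²) = Σ a_{n+1} x^{2n+2}` on the real line. [cite: MullerSchiemann1987, (2.15) p.265] -/
def gR (x : ℝ) : ℝ := ∑' n : ℕ, fA n * x ^ (2 * n + 2)

/-- `Σ |x|^{2n+k}` converges for `|x| < 1`. [folklore] -/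
private theorem summable_geom_sq {x : ℝ} (hx : |x| < 1) (k : ℕ) : Summable fun n : ℕ => |x| ^ (2 * n + k) := by
  have h : Summable fun n : ℕ => (|x| ^ 2) ^ n * |x| ^ k :=
    (summable_geometric_of_lt_one (by positivity) (by nlinarith [abs_nonneg x])).mul_right _
  simpa [pow_add, pow_mul] using h

/-- Convergence of `k` on `(−1, 1)`. [folklore] -/
private theorem summable_kR {x : ℝ} (hx : |x| < 1) : Summable fun n : ℕ => cK n * x ^ (2 * n + 1) := by
  refine Summable.of_norm_bounded (g := fun n => |x| ^ (2 * n + 1)) (summable_geom_sq hx 1) fun n => ?_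
  rw [Real.norm_eq_abs, abs_mul, abs_of_pos (cK_pos n), abs_pow]
  exact mul_le_of_le_one_left (by positivity) (cK_le_one n)

/-- Convergence of `g` on `(−1, 1)`. [folklore] -/
private theorem summable_gR {x : ℝ} (hx : |x| < 1) : Summable fun n : ℕ => fA n * x ^ (2 * n + 2) := by
  refine Summable.of_norm_bounded (g := fun n => |x| ^ (2 * n + 2)) (summable_geom_sq hx 2) fun n => ?_
  rw [Real.norm_eq_abs, abs_mul, abs_of_pos (fA_pos n), abs_pow]
  exact mul_le_of_le_one_left (by positivity) (fA_le_one n)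

/-- The summable majorant `(2n+2) r^{2n}` used for termwise differentiation on `|x| < r < 1`. [folklore] -/
private theorem summable_majorant {r : ℝ} (hr0 : 0 < r) (hr1 : r < 1) :
    Summable fun n : ℕ => (2 * (n : ℝ) + 2) * r ^ (2 * n) := by
  have hq : ‖r ^ 2‖ < 1 := by rw [Real.norm_eq_abs, abs_of_pos (by positivity)]; nlinarith
  have h1 : Summable fun n : ℕ => (n : ℝ) ^ 1 * (r ^ 2) ^ n := summable_pow_mul_geometric_of_norm_lt_one 1 hq
  have h2 : Summable fun n : ℕ => (r ^ 2) ^ n := summable_geometric_of_lt_one (by positivity) (by nlinarith)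
  have := (h1.mul_left 2).add (h2.mul_left 2)
  refine this.congr fun n => ?_
  rw [← pow_mul]; ring

/-- **`g′ = 2k` on `(−1, 1)`** (termwise: `(a_{n+1}x^{2n+2})′ = 2c_n x^{2n+1}`, as `(2n+2)a_{n+1} = 2c_n`).
[cite: MullerSchiemann1987, (2.15) p.265] -/
theorem hasDerivAt_gR {x : ℝ} (hx : |x| < 1) : HasDerivAt gR (2 * kR x) x := by
  obtain ⟨r, hxr, hr1⟩ := exists_between hx
  have hr0 : 0 < r := (abs_nonneg _).trans_lt hxr
  have h := hasDerivAt_tsum_of_isPreconnected (t := Metric.ball (0 : ℝ) r)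
    (g := fun n y => fA n * y ^ (2 * n + 2)) (g' := fun n y => 2 * (cK n * y ^ (2 * n + 1)))
    (u := fun n : ℕ => (2 * (n : ℝ) + 2) * r ^ (2 * n)) (y₀ := 0) (y := x)
    (summable_majorant hr0 hr1) Metric.isOpen_ball (convex_ball _ _).isPreconnected ?_ ?_
    (Metric.mem_ball_self hr0) (summable_gR (x := 0) (by simp)) (by simpa using hxr)
  · rw [kR, ← tsum_mul_left]; exact h
  · intro n y _
    refine ((hasDerivAt_pow (2 * n + 2) y).const_mul (fA n)).congr_deriv ?_
    rw [fA, show 2 * n + 2 - 1 = 2 * n + 1 from rfl]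
    push_cast
    field_simp
  · intro n y hy
    rw [Metric.mem_ball, dist_zero_right, Real.norm_eq_abs] at hy
    rw [Real.norm_eq_abs, abs_mul, abs_mul, abs_of_pos (cK_pos n), abs_pow, abs_two]
    calc 2 * (cK n * |y| ^ (2 * n + 1)) ≤ 2 * (1 * r ^ (2 * n + 1)) :=
          mul_le_mul_of_nonneg_left (mul_le_mul (cK_le_one n) (pow_le_pow_left₀ (abs_nonneg y) hy.le _)
            (by positivity) zero_le_one) (by norm_num)
      _ = (2 * r) * r ^ (2 * n) := by ring
      _ ≤ (2 * n + 2) * r ^ (2 * n) := by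
          refine mul_le_mul_of_nonneg_right ?_ (by positivity)
          have : (0 : ℝ) ≤ n := n.cast_nonneg
          linarith

/-- **`k′` is the termwise derivative of `k` on `(−1, 1)`**. [cite: MullerSchiemann1987, (2.15) p.265] -/
theorem hasDerivAt_kR {x : ℝ} (hx : |x| < 1) : HasDerivAt kR (kR' x) x := by
  obtain ⟨r, hxr, hr1⟩ := exists_between hx
  have hr0 : 0 < r := (abs_nonneg _).trans_lt hxr
  have h := hasDerivAt_tsum_of_isPreconnected (t := Metric.ball (0 : ℝ) r)
    (g := fun n y => cK n * y ^ (2 * n + 1)) (g' := fun n y => (2 * n + 1) * cK n * y ^ (2 * n))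
    (u := fun n : ℕ => (2 * (n : ℝ) + 2) * r ^ (2 * n)) (y₀ := 0) (y := x)
    (summable_majorant hr0 hr1) Metric.isOpen_ball (convex_ball _ _).isPreconnected ?_ ?_
    (Metric.mem_ball_self hr0) (summable_kR (x := 0) (by simp)) (by simpa using hxr)
  · exact h
  · intro n y _
    refine ((hasDerivAt_pow (2 * n + 1) y).const_mul (cK n)).congr_deriv ?_
    rw [show 2 * n + 1 - 1 = 2 * n from rfl]
    push_cast
    ring
  · intro n y hy
    rw [Metric.mem_ball, dist_zero_right, Real.norm_eq_abs] at hy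
    rw [Real.norm_eq_abs, abs_mul, abs_mul, abs_of_pos (cK_pos n), abs_pow,
      abs_of_nonneg (by positivity : (0 : ℝ) ≤ 2 * n + 1)]
    calc (2 * n + 1) * cK n * |y| ^ (2 * n) ≤ (2 * n + 2) * 1 * r ^ (2 * n) :=
          mul_le_mul (mul_le_mul (by linarith) (cK_le_one n) (cK_pos n).le (by positivity))
            (pow_le_pow_left₀ (abs_nonneg y) hy.le _) (by positivity) (by positivity)
      _ = (2 * n + 2) * r ^ (2 * n) := by ring

/-- Convergence of `k′` on `(−1, 1)`. [folklore] -/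
private theorem summable_kR' {x : ℝ} (hx : |x| < 1) : Summable fun n : ℕ => (2 * n + 1) * cK n * x ^ (2 * n) := by
  obtain ⟨r, hxr, hr1⟩ := exists_between hx
  have hr0 : 0 < r := (abs_nonneg _).trans_lt hxr
  refine Summable.of_norm_bounded (summable_majorant hr0 hr1) fun n => ?_
  rw [Real.norm_eq_abs, abs_mul, abs_mul, abs_of_pos (cK_pos n), abs_pow,
    abs_of_nonneg (by positivity : (0 : ℝ) ≤ 2 * n + 1)]
  calc (2 * n + 1) * cK n * |x| ^ (2 * n) ≤ (2 * n + 2) * 1 * r ^ (2 * n) :=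
        mul_le_mul (mul_le_mul (by linarith) (cK_le_one n) (cK_pos n).le (by positivity))
          (pow_le_pow_left₀ (abs_nonneg x) hxr.le _) (by positivity) (by positivity)
    _ = (2 * n + 2) * r ^ (2 * n) := by ring

/-- **The differential equation of `k`**: `(1 − x²) k′(x) − x k(x) = 1` on `(−1, 1)` — coefficientwise this is exactly
the recurrence `(2n+3)c_{n+1} = (2n+2)c_n` and `c₀ = 1`. [cite: MullerSchiemann1987, (2.15) p.265] -/
theorem kR_ode {x : ℝ} (hx : |x| < 1) : (1 - x ^ 2) * kR' x - x * kR x = 1 := by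
  have hs1 := summable_kR' hx
  have hs2 := summable_kR hx
  -- `x² k′ + x k = Σ (2n+2) c_n x^{2n+2} = Σ (2n+3) c_{n+1} x^{2n+2} = k′ − c₀`
  have hA : x ^ 2 * kR' x + x * kR x = ∑' n : ℕ, (2 * n + 2) * cK n * x ^ (2 * n + 2) := by
    rw [kR', kR, ← tsum_mul_left, ← tsum_mul_left, ← (hs1.mul_left _).tsum_add (hs2.mul_left _)]
    refine tsum_congr fun n => ?_
    ring
  have hs3 : Summable fun n : ℕ => (2 * n + 2) * cK n * x ^ (2 * n + 2) := by
    have := (hs1.mul_left (x ^ 2)).add (hs2.mul_left x)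
    refine this.congr fun n => ?_
    ring
  have hB : kR' x = 1 + ∑' n : ℕ, (2 * n + 2) * cK n * x ^ (2 * n + 2) := by
    rw [kR', hs1.tsum_eq_zero_add]
    congr 1
    · simp
    · refine tsum_congr fun n => ?_
      have := cK_succ_mul n
      push_cast
      rw [show 2 * (n + 1) = 2 * n + 2 by ring]
      calc (2 * ((n : ℝ) + 1) + 1) * cK (n + 1) * x ^ (2 * n + 2) = ((2 * n + 3) * cK (n + 1)) * x ^ (2 * n + 2) := by ring
        _ = ((2 * n + 2) * cK n) * x ^ (2 * n + 2) := by rw [this]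
        _ = (2 * n + 2) * cK n * x ^ (2 * n + 2) := by ring
  have : (1 - x ^ 2) * kR' x - x * kR x = kR' x - (x ^ 2 * kR' x + x * kR x) := by ring
  rw [this, hA, hB]
  ring

/-- `k_A(x) = arcsin x/√(1 − x²)`. [cite: MullerSchiemann1987, (2.15) p.265] -/
def kA (x : ℝ) : ℝ := Real.arcsin x / √(1 - x ^ 2)

/-- `|x| < 1 ⇒ 0 < 1 − x²`. [folklore] -/
private theorem one_sub_sq_pos {x : ℝ} (hx : |x| < 1) : 0 < 1 - x ^ 2 := by
  have := abs_lt.mp hx; nlinarith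

/-- `(√(1 − x²))′ = −x/√(1 − x²)` on `(−1, 1)`. [folklore] -/
private theorem hasDerivAt_sqrt_one_sub_sq {x : ℝ} (hx : |x| < 1) :
    HasDerivAt (fun y => √(1 - y ^ 2)) (-x / √(1 - x ^ 2)) x := by
  have h1 : HasDerivAt (fun y => 1 - y ^ 2) (-(2 * x)) x := by
    simpa using (hasDerivAt_pow 2 x).const_sub 1
  have h2 := h1.sqrt (one_sub_sq_pos hx).ne'
  refine h2.congr_deriv ?_
  field_simp

/-- **The same differential equation for `arcsin x/√(1 − x²)`**: `k_A′ = (1 + x k_A)/(1 − x²)`. [cite: MullerSchiemann1987, (2.15) p.265] -/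
theorem hasDerivAt_kA {x : ℝ} (hx : |x| < 1) : HasDerivAt kA ((1 + x * kA x) / (1 - x ^ 2)) x := by
  have hlt := abs_lt.mp hx
  have hpos := one_sub_sq_pos hx
  have hsq : 0 < √(1 - x ^ 2) := Real.sqrt_pos.mpr hpos
  have h1 := Real.hasDerivAt_arcsin (by linarith : x ≠ -1) (by linarith : x ≠ 1)
  have h2 := hasDerivAt_sqrt_one_sub_sq hx
  have h := h1.div h2 hsq.ne'
  refine h.congr_deriv ?_
  rw [kA, Real.sq_sqrt hpos.le]
  field_simp
  ring

/-- Uniqueness for the first-order equation: **`k = arcsin x/√(1 − x²)` on `(−1, 1)`** (`φ = (k − k_A)√(1 − x²)` has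
zero derivative and `φ(0) = 0`). [cite: MullerSchiemann1987, (2.15) p.265] -/
theorem kR_eq_kA {x : ℝ} (hx : |x| < 1) : kR x = kA x := by
  set φ : ℝ → ℝ := fun y => (kR y - kA y) * √(1 - y ^ 2) with hφ
  have hderiv : ∀ y ∈ Ioo (-1 : ℝ) 1, HasDerivAt φ 0 y := by
    intro y hy
    have hy' : |y| < 1 := abs_lt.mpr hy
    have hpos := one_sub_sq_pos hy'
    have hsq : 0 < √(1 - y ^ 2) := Real.sqrt_pos.mpr hpos
    have h := ((hasDerivAt_kR hy').sub (hasDerivAt_kA hy')).mul (hasDerivAt_sqrt_one_sub_sq hy')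
    refine h.congr_deriv ?_
    have hode := kR_ode hy'
    have h1 : kR' y - (1 + y * kA y) / (1 - y ^ 2) = y * (kR y - kA y) / (1 - y ^ 2) := by
      field_simp
      linear_combination hode
    simp only [Pi.sub_apply]
    rw [h1]
    have hs : √(1 - y ^ 2) ^ 2 = 1 - y ^ 2 := Real.sq_sqrt hpos.le
    field_simp
    rw [hs]
    ring
  have hconst : φ x = φ 0 := by
    have hdiff : DifferentiableOn ℝ φ (Ioo (-1 : ℝ) 1) := fun y hy =>
      (hderiv y hy).differentiableAt.differentiableWithinAt
    refine (convex_Ioo (-1 : ℝ) 1).is_const_of_fderivWithin_eq_zero hdiff (fun y hy => ?_)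
      (abs_lt.mp hx) (by norm_num)
    rw [fderivWithin_of_isOpen isOpen_Ioo hy, (hderiv y hy).hasFDerivAt.fderiv]
    simp
  have h0 : φ 0 = 0 := by simp [hφ, kR, kA]
  rw [h0, hφ] at hconst
  have hsq : √(1 - x ^ 2) ≠ 0 := (Real.sqrt_pos.mpr (one_sub_sq_pos hx)).ne'
  have := (mul_eq_zero.mp hconst).resolve_right hsq
  linarith

/-- **`g(x) = arcsin²x` on `(−1, 1)`**: both have derivative `2 arcsin x/√(1 − x²)` and vanish at `0`.
[cite: MullerSchiemann1987, (2.15) p.265] -/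
theorem gR_eq_arcsin_sq {x : ℝ} (hx : |x| < 1) : gR x = Real.arcsin x ^ 2 := by
  set ψ : ℝ → ℝ := fun y => gR y - Real.arcsin y ^ 2 with hψ
  have hderiv : ∀ y ∈ Ioo (-1 : ℝ) 1, HasDerivAt ψ 0 y := by
    intro y hy
    have hy' : |y| < 1 := abs_lt.mpr hy
    have h1 := hasDerivAt_gR hy'
    have h2 := (Real.hasDerivAt_arcsin (by linarith [hy.1] : y ≠ -1) (by linarith [hy.2] : y ≠ 1)).pow 2
    refine (h1.sub h2).congr_deriv ?_
    rw [kR_eq_kA hy', kA]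
    ring
  have hconst : ψ x = ψ 0 := by
    have hdiff : DifferentiableOn ℝ ψ (Ioo (-1 : ℝ) 1) := fun y hy =>
      (hderiv y hy).differentiableAt.differentiableWithinAt
    refine (convex_Ioo (-1 : ℝ) 1).is_const_of_fderivWithin_eq_zero hdiff (fun y hy => ?_)
      (abs_lt.mp hx) (by norm_num)
    rw [fderivWithin_of_isOpen isOpen_Ioo hy, (hderiv y hy).hasFDerivAt.fderiv]
    simp
  have h0 : ψ 0 = 0 := by simp [hψ, gR]
  rw [h0, hψ] at hconst
  simpa [sub_eq_zero] using hconst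

/-- `f(x²) = g(x)` for real `|x| < 1` (the complex series at a real point). [cite: MullerSchiemann1987, (2.15) p.265] -/
theorem fC_ofReal_sq (x : ℝ) : fC ((x : ℂ) ^ 2) = (gR x : ℂ) := by
  rw [fC, gR, Complex.ofReal_tsum]
  refine tsum_congr fun n => ?_
  push_cast
  ring

/-- **`f` inverts `η = sin²y ↦ y²`**: `f(sin²y) = y²` for `|y| < π/2`. [cite: MullerSchiemann1987, Prop. 1 p.264, (2.15) p.265] -/
theorem fC_sin_sq {y : ℝ} (hy : |y| < π / 2) : fC ((Real.sin y : ℂ) ^ 2) = (y : ℂ) ^ 2 := by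
  have hlt := abs_lt.mp hy
  have hs : |Real.sin y| < 1 := by
    rw [abs_lt]
    constructor
    · have e : Real.sin (-(π / 2)) = -1 := by rw [Real.sin_neg, Real.sin_pi_div_two]
      rw [← e]
      exact Real.sin_lt_sin_of_lt_of_le_pi_div_two (by linarith) (by linarith) (by linarith)
    · rw [← Real.sin_pi_div_two]
      exact Real.sin_lt_sin_of_lt_of_le_pi_div_two (by linarith) le_rfl hlt.2
  rw [fC_ofReal_sq, gR_eq_arcsin_sq hs, Real.arcsin_sin (by linarith) (by linarith)]
  push_cast
  ring

/-- `4f(½(1 − cos θ)) = θ²` for real `|θ| < π` — (2.13) at `z = 0`, `u = e^{−iθσ₃}`: `η = sin²(θ/2)`.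
[cite: MullerSchiemann1987, (2.13) p.264] -/
theorem four_fC_half_one_sub_cos {θ : ℝ} (hθ : |θ| < π) :
    4 * fC ((((1 - Real.cos θ) / 2 : ℝ)) : ℂ) = (θ : ℂ) ^ 2 := by
  have h1 : (1 - Real.cos θ) / 2 = Real.sin (θ / 2) ^ 2 := by
    rw [Real.sin_sq_eq_half_sub, show 2 * (θ / 2) = θ by ring]; ring
  have h2 : |θ / 2| < π / 2 := by rw [abs_div, abs_two]; linarith
  rw [h1, Complex.ofReal_pow, fC_sin_sq h2]
  push_cast
  ring

/-! ### §4. `cos θ` as an entire function of `θ²`, and `cos θ = 1 − 2η` whenever `θ² = 4f(η)`, `|η| < 1` -/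

/-- `C(w) = Σ (−1)ⁿ wⁿ/(2n)!`, the entire function with `cos θ = C(θ²)`. [cite: MullerSchiemann1987, Prop. 1 p.264] -/
def cosSq (w : ℂ) : ℂ := ∑' n : ℕ, (-1) ^ n * w ^ n / ((2 * n).factorial : ℂ)

/-- `cos θ = C(θ²)` (the cosine power series). [cite: MullerSchiemann1987, Prop. 1 p.264] -/
theorem cos_eq_cosSq (θ : ℂ) : Complex.cos θ = cosSq (θ ^ 2) := by
  rw [cosSq, ← (Complex.hasSum_cos θ).tsum_eq]
  refine tsum_congr fun n => ?_
  rw [pow_mul]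

/-- `C` is holomorphic on every disc (terms bounded by `Rⁿ/n!`). [cite: MullerSchiemann1987, Prop. 1 p.264] -/
theorem differentiableOn_cosSq (R : ℝ) : DifferentiableOn ℂ cosSq (Metric.ball 0 R) := by
  refine Complex.differentiableOn_tsum_of_summable_norm (u := fun n : ℕ => |R| ^ n / n.factorial)
    (Real.summable_pow_div_factorial |R|) (fun n => ?_) Metric.isOpen_ball (fun n w hw => ?_)
  · exact ((differentiable_pow n).const_mul _).div_const _ |>.differentiableOn
  · rw [Metric.mem_ball, dist_zero_right] at hw
    rw [norm_div, norm_mul, norm_pow, norm_pow, norm_neg, norm_one, one_pow, one_mul, Complex.norm_natCast]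
    have h1 : ‖w‖ ^ n ≤ |R| ^ n := pow_le_pow_left₀ (norm_nonneg _) (hw.le.trans (le_abs_self R)) n
    have h2 : ((n.factorial : ℕ) : ℝ) ≤ ((2 * n).factorial : ℕ) := by
      exact_mod_cast Nat.factorial_le (by omega)
    have h3 : (0 : ℝ) < n.factorial := by positivity
    calc ‖w‖ ^ n / ((2 * n).factorial : ℝ) ≤ |R| ^ n / (n.factorial : ℝ) :=
          div_le_div₀ (by positivity) h1 h3 h2
      _ = |R| ^ n / n.factorial := rfl

/-- `C` is entire. [cite: MullerSchiemann1987, Prop. 1 p.264] -/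
theorem differentiable_cosSq : Differentiable ℂ cosSq := fun w =>
  (differentiableOn_cosSq (‖w‖ + 1)).differentiableAt
    (Metric.isOpen_ball.mem_nhds (by simp))

/-- **The identity behind Proposition 1**: `C(4f(η)) = 1 − 2η` on the whole disc `|η| < 1` — both sides are holomorphic
there and they agree at the real points `η = sin²t` (where `4f(η) = (2t)²` and `cos 2t = 1 − 2sin²t`); identity
theorem. [cite: MullerSchiemann1987, Prop. 1 and (2.13) p.264] -/
theorem cosSq_four_fC {η : ℂ} (hη : ‖η‖ < 1) : cosSq (4 * fC η) = 1 - 2 * η := by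
  have hball : η ∈ Metric.ball (0 : ℂ) 1 := by simpa using hη
  have hF : DifferentiableOn ℂ (fun η => cosSq (4 * fC η)) (Metric.ball 0 1) :=
    differentiable_cosSq.comp_differentiableOn (differentiableOn_fC.const_mul 4)
  have hG : DifferentiableOn ℂ (fun η : ℂ => 1 - 2 * η) (Metric.ball 0 1) :=
    ((differentiable_id.const_mul _).const_sub _).differentiableOn
  have hFa := (Complex.analyticOnNhd_iff_differentiableOn Metric.isOpen_ball).mpr hF
  have hGa := (Complex.analyticOnNhd_iff_differentiableOn Metric.isOpen_ball).mpr hG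
  refine hFa.eqOn_of_preconnected_of_frequently_eq hGa (convex_ball _ _).isPreconnected
    (Metric.mem_ball_self one_pos) ?_ hball
  refine Filter.frequently_iff.mpr fun {U} hU => ?_
  obtain ⟨ε, hε, hsub⟩ := Metric.mem_nhdsWithin_iff.mp hU
  set t : ℝ := min (1 / 2) (ε / 2) with ht
  have ht0 : 0 < t := lt_min (by norm_num) (by positivity)
  have ht1 : t ≤ 1 / 2 := min_le_left _ _
  have ht2 : t ≤ ε / 2 := min_le_right _ _
  have hsin0 : Real.sin t ≠ 0 :=
    (Real.sin_pos_of_pos_of_lt_pi ht0 (by linarith [Real.pi_gt_three])).ne'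
  refine ⟨((Real.sin t : ℝ) : ℂ) ^ 2, hsub ⟨?_, ?_⟩, ?_⟩
  · rw [Metric.mem_ball, dist_zero_right, norm_pow, Complex.norm_real, Real.norm_eq_abs]
    have hs : |Real.sin t| ≤ t := by
      rw [abs_of_nonneg (Real.sin_nonneg_of_nonneg_of_le_pi ht0.le (by linarith [Real.pi_gt_three]))]
      exact Real.sin_le ht0.le
    calc |Real.sin t| ^ 2 ≤ t ^ 2 := pow_le_pow_left₀ (abs_nonneg _) hs 2
      _ ≤ (ε / 2) * (1 / 2) := by rw [sq]; exact mul_le_mul ht2 ht1 ht0.le (by positivity)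
      _ < ε := by linarith
  · simp only [Set.mem_compl_iff, Set.mem_singleton_iff, pow_eq_zero_iff, ne_eq, OfNat.ofNat_ne_zero,
      not_false_eq_true, Complex.ofReal_eq_zero]
    exact hsin0
  · have h2t : |t| < π / 2 := by rw [abs_of_pos ht0]; linarith [Real.pi_gt_three]
    show cosSq (4 * fC (((Real.sin t : ℝ) : ℂ) ^ 2)) = 1 - 2 * ((Real.sin t : ℝ) : ℂ) ^ 2
    rw [fC_sin_sq h2t, show (4 : ℂ) * (t : ℂ) ^ 2 = (2 * t) ^ 2 by ring, ← cos_eq_cosSq, Complex.cos_two_mul]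
    push_cast
    linear_combination (2 : ℂ) * Complex.sin_sq_add_cos_sq (t : ℂ)

/-- **Proposition 1, the inversion**: if `|η| < 1` and `θ² = 4f(η)` then `cos θ = 1 − 2η` (i.e. `η = sin²(θ/2)`).
[cite: MullerSchiemann1987, Prop. 1 and (2.13) p.264] -/
theorem cos_eq_one_sub_two_mul {η θ : ℂ} (hη : ‖η‖ < 1) (h : θ ^ 2 = 4 * fC η) :
    Complex.cos θ = 1 - 2 * η := by
  rw [cos_eq_cosSq, h, cosSq_four_fC hη]

/-! ### §6 (v1.1). The Remark after Proposition 1: `|Im θ(u, z)| ≤ |Im z|`, branch-free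

p.265: *«It is important to note that |Im θ(u, z)| ≤ |Im z| in the domain of θ. This is deduced from the map
{θ : |Im θ| = t} —ω = cos θ→ {ω : (Re ω/cosh t)² + (Im ω/sinh t)² = 1} for arbitrary t > 0, taking into account
cos θ = u₀ cos z + u₃ sin z due to (2.17). A similar consideration yields |Im θ̌(u, z)| ≤ |Im z| in the domain of θ̌.»*
Formalized for ANY `θ` with `cos θ = u₀ cos z + u₃ sin z`, `u₀² + u₃² ≤ 1` (no branch needed): writing `z = x + it`,
`u₀ cos z + u₃ sin z` has real part `(u₀ cos x + u₃ sin x) cosh t` and imaginary part `(u₃ cos x − u₀ sin x) sinh t` with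
`(u₀ cos x + u₃ sin x)² + (u₃ cos x − u₀ sin x)² = u₀² + u₃² ≤ 1`, i.e. it lies inside the `|t|`-ellipse, while
`cos(a + ib)` lies on the `|b|`-ellipse, which is strictly outside the `|t|`-one when `|b| > |t|`. -/

/-- **`|Im θ| ≤ |Im z|` whenever `cos θ = u₀ cos z + u₃ sin z` with `u₀² + u₃² ≤ 1`** (the Remark after Proposition 1,
for either branch and also with `u₀, u₃` replaced by `−u₀, −u₃`, i.e. for `θ̌`). [cite: MullerSchiemann1987, Remark p.265] -/
theorem abs_im_le_of_cos_eq {u₀ u₃ : ℝ} (hu : u₀ ^ 2 + u₃ ^ 2 ≤ 1) {θ z : ℂ}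
    (h : Complex.cos θ = u₀ * Complex.cos z + u₃ * Complex.sin z) : |θ.im| ≤ |z.im| := by
  -- real and imaginary parts of both sides
  set a := θ.re; set b := θ.im; set x := z.re; set t := z.im
  set P := u₀ * Real.cos x + u₃ * Real.sin x with hP
  set Q := u₃ * Real.cos x - u₀ * Real.sin x with hQ
  have ec : ∀ w : ℂ, Complex.cos w = ((Real.cos w.re * Real.cosh w.im : ℝ) : ℂ) +
      ((-(Real.sin w.re * Real.sinh w.im) : ℝ) : ℂ) * Complex.I := fun w => by
    rw [Complex.cos_eq]; push_cast; ring
  have es : ∀ w : ℂ, Complex.sin w = ((Real.sin w.re * Real.cosh w.im : ℝ) : ℂ) +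
      ((Real.cos w.re * Real.sinh w.im : ℝ) : ℂ) * Complex.I := fun w => by
    rw [Complex.sin_eq]; push_cast; ring
  rw [ec θ, ec z, es z] at h
  have hre' := congrArg Complex.re h
  have him' := congrArg Complex.im h
  simp only [Complex.add_re, Complex.mul_re, Complex.ofReal_re, Complex.ofReal_im, Complex.I_re, Complex.I_im,
    Complex.add_im, Complex.mul_im, mul_zero, zero_mul, sub_zero, add_zero, mul_one, zero_add] at hre' him'
  have hre : Real.cos a * Real.cosh b = P * Real.cosh t := by rw [hP]; linarith
  have him : Real.sin a * Real.sinh b = -(Q * Real.sinh t) := by rw [hQ]; linarith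
  have hPQ : P ^ 2 + Q ^ 2 ≤ 1 := by
    have e : P ^ 2 + Q ^ 2 = (u₀ ^ 2 + u₃ ^ 2) * (Real.cos x ^ 2 + Real.sin x ^ 2) := by rw [hP, hQ]; ring
    rw [e, Real.cos_sq_add_sin_sq, mul_one]; exact hu
  by_contra hlt
  push Not at hlt
  -- `|t| < |b|`: the `b`-ellipse is strictly outside the `t`-ellipse
  have hC : Real.cosh t < Real.cosh b := Real.cosh_lt_cosh.mpr hlt
  have hCt : 1 ≤ Real.cosh t := Real.one_le_cosh t
  have hSb : Real.sinh b ^ 2 = Real.cosh b ^ 2 - 1 := Real.sinh_sq b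
  have hSt : Real.sinh t ^ 2 = Real.cosh t ^ 2 - 1 := Real.sinh_sq t
  have hCC : Real.cosh t ^ 2 < Real.cosh b ^ 2 := by nlinarith
  have hSb0 : 0 < Real.sinh b ^ 2 := by rw [hSb]; nlinarith
  have h1 : Real.cos a ^ 2 + Real.sin a ^ 2 = 1 := Real.cos_sq_add_sin_sq a
  have e2 : Real.cos a ^ 2 * Real.cosh b ^ 2 = P ^ 2 * Real.cosh t ^ 2 := by
    rw [← mul_pow, ← mul_pow, hre]
  have e3 : Real.sin a ^ 2 * Real.sinh b ^ 2 = Q ^ 2 * Real.sinh t ^ 2 := by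
    rw [← mul_pow, ← mul_pow, him, neg_sq]
  -- `Cb²Sb² = P²Ct²Sb² + Q²St²Cb² ≤ (P² + Q²)Ct²Sb² ≤ Ct²Sb² < Cb²Sb²`
  have key : Real.cosh b ^ 2 * Real.sinh b ^ 2 =
      P ^ 2 * Real.cosh t ^ 2 * Real.sinh b ^ 2 + Q ^ 2 * Real.sinh t ^ 2 * Real.cosh b ^ 2 := by
    calc Real.cosh b ^ 2 * Real.sinh b ^ 2
        = (Real.cos a ^ 2 + Real.sin a ^ 2) * Real.cosh b ^ 2 * Real.sinh b ^ 2 := by rw [h1, one_mul]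
      _ = (Real.cos a ^ 2 * Real.cosh b ^ 2) * Real.sinh b ^ 2 +
            (Real.sin a ^ 2 * Real.sinh b ^ 2) * Real.cosh b ^ 2 := by ring
      _ = _ := by rw [e2, e3]
  have hQ' : Q ^ 2 * Real.sinh t ^ 2 * Real.cosh b ^ 2 ≤ Q ^ 2 * Real.cosh t ^ 2 * Real.sinh b ^ 2 := by
    rw [hSt, hSb]
    nlinarith [mul_le_mul_of_nonneg_left hCC.le (sq_nonneg Q)]
  have hB : (P ^ 2 + Q ^ 2) * (Real.cosh t ^ 2 * Real.sinh b ^ 2) ≤ 1 * (Real.cosh t ^ 2 * Real.sinh b ^ 2) :=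
    mul_le_mul_of_nonneg_right hPQ (by positivity)
  have hD : Real.cosh t ^ 2 * Real.sinh b ^ 2 < Real.cosh b ^ 2 * Real.sinh b ^ 2 :=
    mul_lt_mul_of_pos_right hCC hSb0
  nlinarith [key, hQ', hB, hD]

/-! ### §5. (2.13)–(2.14) and Proposition 1 for the heat-kernel action -/

section OnSU2

local notation "SU2" => Matrix.specialUnitaryGroup (Fin 2) ℂ

open HeatKernel

/-- `η(u, z) = ½{1 − u₀ cos z − u₃ sin z}` (the argument of `f` in (2.13)). [cite: MullerSchiemann1987, (2.13) p.264] -/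
def etaOf (U : SU2) (z : ℂ) : ℂ := (1 - ((u0 U : ℂ) * Complex.cos z + (u3 U : ℂ) * Complex.sin z)) / 2

/-- `η̌(u, z) = ½{1 + u₀ cos z + u₃ sin z}` (the argument of `f` in (2.14)). [cite: MullerSchiemann1987, (2.14) p.264] -/
def etaCheckOf (U : SU2) (z : ℂ) : ℂ := (1 + ((u0 U : ℂ) * Complex.cos z + (u3 U : ℂ) * Complex.sin z)) / 2

/-- **(2.13)**: `θ²(u, z) = 4f(½{1 − u₀ cos z − u₃ sin z})`. [cite: MullerSchiemann1987, (2.13) p.264] -/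
def thetaSq (U : SU2) (z : ℂ) : ℂ := 4 * fC (etaOf U z)

/-- **(2.14)**: `θ̌²(u, z) = 4f(½{1 + u₀ cos z + u₃ sin z})`. [cite: MullerSchiemann1987, (2.14) p.264] -/
def thetaCheckSq (U : SU2) (z : ℂ) : ℂ := 4 * fC (etaCheckOf U z)

/-- `z ↦ η(u, z)` is entire. [cite: MullerSchiemann1987, (2.13) p.264] -/
theorem differentiable_etaOf (U : SU2) : Differentiable ℂ (etaOf U) :=
  (((Complex.differentiable_cos.const_mul _).add (Complex.differentiable_sin.const_mul _)).const_sub _).div_const _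

/-- `z ↦ η̌(u, z)` is entire. [cite: MullerSchiemann1987, (2.14) p.264] -/
theorem differentiable_etaCheckOf (U : SU2) : Differentiable ℂ (etaCheckOf U) :=
  (((Complex.differentiable_cos.const_mul _).add (Complex.differentiable_sin.const_mul _)).const_add _).div_const _

/-- **`θ²(u, ·)` is holomorphic in `z`** on its domain `{z : |η(u, z)| < 1}` («holomorphic in z in their respective
domains», p.265). [cite: MullerSchiemann1987, Prop. 1 pp.264–265] -/
theorem differentiableOn_thetaSq (U : SU2) : DifferentiableOn ℂ (thetaSq U) {z | ‖etaOf U z‖ < 1} := by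
  refine DifferentiableOn.const_mul (differentiableOn_fC.comp (differentiable_etaOf U).differentiableOn ?_) 4
  intro z hz
  simpa using hz

/-- **`θ̌²(u, ·)` is holomorphic in `z`** on `{z : |η̌(u, z)| < 1}`. [cite: MullerSchiemann1987, Prop. 1 pp.264–265] -/
theorem differentiableOn_thetaCheckSq (U : SU2) :
    DifferentiableOn ℂ (thetaCheckSq U) {z | ‖etaCheckOf U z‖ < 1} := by
  refine DifferentiableOn.const_mul (differentiableOn_fC.comp (differentiable_etaCheckOf U).differentiableOn ?_) 4
  intro z hz
  simpa using hz

/-- **`θ²(·, z)` is continuous in `u`** on `{u : |η(u, z)| < 1}` («continuous in u», p.265). [cite: MullerSchiemann1987, Prop. 1 pp.264–265] -/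
theorem continuousOn_thetaSq (z : ℂ) : ContinuousOn (fun U : SU2 => thetaSq U z) {U | ‖etaOf U z‖ < 1} := by
  have hc : Continuous fun U : SU2 => etaOf U z := by
    unfold etaOf
    exact (continuous_const.sub (((Complex.continuous_ofReal.comp continuous_u0).mul continuous_const).add
      ((Complex.continuous_ofReal.comp continuous_u3).mul continuous_const))).div_const _
  have h2 : ContinuousOn (fun U : SU2 => fC (etaOf U z)) {U | ‖etaOf U z‖ < 1} :=
    differentiableOn_fC.continuousOn.comp hc.continuousOn fun U hU => by simpa using hU
  show ContinuousOn (fun U : SU2 => 4 * fC (etaOf U z)) _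
  exact continuousOn_const.mul h2

/-- **Proposition 1 for the heat-kernel action, first case**: if `|η(u, z)| < 1` and `θ` is any complex number with
`θ² = θ²(u, z)` (2.13), then `g̃_HK(u, z) = h(θ)` — `cos θ = u₀ cos z + u₃ sin z` by `cos_eq_one_sub_two_mul`, and
`g̃_HK(u, z) = hTr(u₀ cos z + u₃ sin z)`, `h(θ) = hTr(cos θ)` (`MS87HeatKernelGroup`, `MS87HeatKernelComplex`). The value
does not depend on the choice of the square root (`h` is even, (2.12)). [cite: MullerSchiemann1987, Prop. 1 p.264] -/
theorem prop1_heatKernel (γ : ℝ) {U : SU2} {z θ : ℂ} (hη : ‖etaOf U z‖ < 1) (hθ : θ ^ 2 = thetaSq U z) :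
    gTildeHK γ U z = hC γ θ := by
  rw [gTildeHK, hC_eq_hTr_cos, cos_eq_one_sub_two_mul hη hθ, etaOf]
  congr 1
  ring

/-- **Proposition 1 for the heat-kernel action, second case**: if `|η̌(u, z)| < 1` and `θ̌² = θ̌²(u, z)` (2.14), then
`g̃_HK(u, z) = h(π − θ̌)` (`cos(π − θ̌) = −cos θ̌ = u₀ cos z + u₃ sin z`). [cite: MullerSchiemann1987, Prop. 1 p.264, (2.14)] -/
theorem prop1_heatKernel_check (γ : ℝ) {U : SU2} {z θ : ℂ} (hη : ‖etaCheckOf U z‖ < 1)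
    (hθ : θ ^ 2 = thetaCheckSq U z) : gTildeHK γ U z = hC γ (π - θ) := by
  rw [gTildeHK, hC_eq_hTr_cos, Complex.cos_pi_sub, cos_eq_one_sub_two_mul hη hθ, etaCheckOf]
  congr 1
  ring

/-- **(2.13) on the group is the squared central angle**: for real `x` and `u` with `u₀(e^{−ixσ₃}u) > −1` (i.e. central
angle `θ(e^{−ixσ₃}u) < π`), `θ²(u, x) = θ(e^{−ixσ₃}u)²` where `cos θ(v) = v₀` (`MS87HeatKernelSU2.centralAngle`), since
`η(u, x) = ½(1 − u₀ cos x − u₃ sin x) = ½(1 − cos θ) = sin²(θ/2)` by (2.17). [cite: MullerSchiemann1987, Prop. 1 and (2.13) p.264, (2.16)–(2.17) p.265] -/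
theorem thetaSq_ofReal (U : SU2) (x : ℝ) (hU : -1 < u0 (diagPhase x * U)) :
    thetaSq U x = ((centralAngle (diagPhase x * U) : ℝ) : ℂ) ^ 2 := by
  set θ := centralAngle (diagPhase x * U) with hθ
  have hcos : Real.cos θ = u0 U * Real.cos x + u3 U * Real.sin x := by
    rw [hθ, centralAngle_eq_arccos_u0, Real.cos_arccos (by linarith [abs_le.mp (abs_u0_le_one (diagPhase x * U))])
      (abs_le.mp (abs_u0_le_one (diagPhase x * U))).2, u0_diagPhase_mul]
  have hθ0 : 0 ≤ θ := by rw [hθ, centralAngle_eq_arccos_u0]; exact Real.arccos_nonneg _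
  have hθπ : θ < π := by
    rw [hθ, centralAngle_eq_arccos_u0]
    exact lt_of_le_of_ne (Real.arccos_le_pi _) fun h => by rw [Real.arccos_eq_pi] at h; linarith
  have heta : etaOf U x = ((((1 - Real.cos θ) / 2 : ℝ)) : ℂ) := by
    rw [etaOf, hcos]; push_cast; ring
  rw [thetaSq, heta, four_fC_half_one_sub_cos (by rw [abs_of_nonneg hθ0]; exact hθπ)]

/-- **The domain of Proposition 1**: `|z| < ¼` and `u₀ > −½` imply `|η(u, z)| < 1` (crudely: `|1 − u₀| < 3/2`,
`|cos z − 1| ≤ |z|²/2 + (5/96)|z|⁴`, `|sin z| ≤ |z| + |z|³/6 + |z|⁵/100`, `|u₀|, |u₃| ≤ 1`).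
[cite: MullerSchiemann1987, Prop. 1 p.264 («for z ∈ ℂ, |z| < ¼ … for u₀ > −½»)] -/
theorem norm_etaOf_lt_one {U : SU2} {z : ℂ} (hz : ‖z‖ < 1 / 4) (hU : -1 / 2 < u0 U) : ‖etaOf U z‖ < 1 := by
  have hz1 : ‖z‖ ≤ 1 := by linarith
  have hcos := Complex.cos_bound hz1
  have hsin := Complex.sin_bound hz1
  have hu0 : |u0 U| ≤ 1 := abs_u0_le_one U
  have hu3 : |u3 U| ≤ 1 := by
    have := u0_sq_add_u3_sq_le_one U
    rw [abs_le]; constructor <;> nlinarith [sq_nonneg (u0 U)]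
  -- |cos z − 1| ≤ |z|²/2 + (5/96)|z|⁴ ≤ 1/32 + 1/96
  have hc1 : ‖Complex.cos z - 1‖ ≤ 1 / 16 := by
    have e : Complex.cos z - 1 = (Complex.cos z - (1 - z ^ 2 / 2)) + (-(z ^ 2 / 2)) := by ring
    rw [e]
    refine (norm_add_le _ _).trans ?_
    rw [norm_neg, norm_div, norm_pow, Complex.norm_ofNat]
    have hz4 : ‖z‖ ^ 4 ≤ (1 / 4) ^ 4 := pow_le_pow_left₀ (norm_nonneg _) hz.le 4
    have hz2 : ‖z‖ ^ 2 ≤ (1 / 4) ^ 2 := pow_le_pow_left₀ (norm_nonneg _) hz.le 2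
    nlinarith
  -- |sin z| ≤ |z| + |z|³/6 + |z|⁵/100 < 0.26
  have hs1 : ‖Complex.sin z‖ ≤ 13 / 50 := by
    have e : Complex.sin z = (Complex.sin z - (z - z ^ 3 / 6)) + (z - z ^ 3 / 6) := by ring
    rw [e]
    refine (norm_add_le _ _).trans ?_
    have h3 : ‖z - z ^ 3 / 6‖ ≤ ‖z‖ + ‖z‖ ^ 3 / 6 := by
      refine (norm_sub_le _ _).trans ?_
      rw [norm_div, norm_pow, Complex.norm_ofNat]
    have hz5 : ‖z‖ ^ 5 ≤ (1 / 4) ^ 5 := pow_le_pow_left₀ (norm_nonneg _) hz.le 5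
    have hz3 : ‖z‖ ^ 3 ≤ (1 / 4) ^ 3 := pow_le_pow_left₀ (norm_nonneg _) hz.le 3
    nlinarith
  -- assemble
  have e : etaOf U z = ((1 - u0 U : ℝ) : ℂ) / 2 - ((u0 U : ℂ) * (Complex.cos z - 1) + (u3 U : ℂ) * Complex.sin z) / 2 := by
    rw [etaOf]; push_cast; ring
  rw [e]
  refine (norm_sub_le _ _).trans_lt ?_
  rw [norm_div, Complex.norm_real, Complex.norm_ofNat, norm_div, Complex.norm_ofNat]
  have h1 : ‖(1 - u0 U : ℝ)‖ < 3 / 2 := by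
    rw [Real.norm_eq_abs, abs_lt]; constructor <;> linarith [abs_le.mp hu0]
  have h2 : ‖(u0 U : ℂ) * (Complex.cos z - 1) + (u3 U : ℂ) * Complex.sin z‖ ≤ 1 * (1 / 16) + 1 * (13 / 50) := by
    refine (norm_add_le _ _).trans (add_le_add ?_ ?_)
    · rw [norm_mul, Complex.norm_real, Real.norm_eq_abs]
      exact mul_le_mul hu0 hc1 (norm_nonneg _) zero_le_one
    · rw [norm_mul, Complex.norm_real, Real.norm_eq_abs]
      exact mul_le_mul hu3 hs1 (norm_nonneg _) zero_le_one
  linarith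

/-- Hence on the printed domain, Proposition 1 (first case) for the heat kernel needs no hypothesis on `η`.
[cite: MullerSchiemann1987, Prop. 1 p.264] -/
theorem prop1_heatKernel_of_small (γ : ℝ) {U : SU2} {z θ : ℂ} (hz : ‖z‖ < 1 / 4) (hU : -1 / 2 < u0 U)
    (hθ : θ ^ 2 = thetaSq U z) : gTildeHK γ U z = hC γ θ :=
  prop1_heatKernel γ (norm_etaOf_lt_one hz hU) hθ

/-- **The Remark's `|Im θ(u, z)| ≤ |Im z|` for (2.13)**: any `θ` with `θ² = θ²(u, z)` (`|η(u, z)| < 1`) satisfies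
`|Im θ| ≤ |Im z|`. [cite: MullerSchiemann1987, Remark p.265] -/
theorem abs_im_le_of_thetaSq {U : SU2} {z θ : ℂ} (hη : ‖etaOf U z‖ < 1) (hθ : θ ^ 2 = thetaSq U z) :
    |θ.im| ≤ |z.im| :=
  abs_im_le_of_cos_eq (u0_sq_add_u3_sq_le_one U) (by rw [cos_eq_one_sub_two_mul hη hθ, etaOf]; ring)

/-- **The Remark's `|Im θ̌(u, z)| ≤ |Im z|` for (2.14)**. [cite: MullerSchiemann1987, Remark p.265] -/
theorem abs_im_le_of_thetaCheckSq {U : SU2} {z θ : ℂ} (hη : ‖etaCheckOf U z‖ < 1) (hθ : θ ^ 2 = thetaCheckSq U z) :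
    |θ.im| ≤ |z.im| := by
  refine abs_im_le_of_cos_eq (u₀ := -u0 U) (u₃ := -u3 U) (by simpa using u0_sq_add_u3_sq_le_one U) ?_
  rw [cos_eq_one_sub_two_mul hη hθ, etaCheckOf]
  push_cast
  ring

/-- The domain of the second case: `|z| < ¼` and `u₀ < ½` imply `|η̌(u, z)| < 1` (same estimate with `|1 + u₀| < 3/2`).
[cite: MullerSchiemann1987, Prop. 1 p.264 («for u₀ < ½»)] -/
theorem norm_etaCheckOf_lt_one {U : SU2} {z : ℂ} (hz : ‖z‖ < 1 / 4) (hU : u0 U < 1 / 2) : ‖etaCheckOf U z‖ < 1 := by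
  have hz1 : ‖z‖ ≤ 1 := by linarith
  have hcos := Complex.cos_bound hz1
  have hsin := Complex.sin_bound hz1
  have hu0 : |u0 U| ≤ 1 := abs_u0_le_one U
  have hu3 : |u3 U| ≤ 1 := by
    have := u0_sq_add_u3_sq_le_one U
    rw [abs_le]; constructor <;> nlinarith [sq_nonneg (u0 U)]
  have hc1 : ‖Complex.cos z - 1‖ ≤ 1 / 16 := by
    have e : Complex.cos z - 1 = (Complex.cos z - (1 - z ^ 2 / 2)) + (-(z ^ 2 / 2)) := by ring
    rw [e]
    refine (norm_add_le _ _).trans ?_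
    rw [norm_neg, norm_div, norm_pow, Complex.norm_ofNat]
    have hz4 : ‖z‖ ^ 4 ≤ (1 / 4) ^ 4 := pow_le_pow_left₀ (norm_nonneg _) hz.le 4
    have hz2 : ‖z‖ ^ 2 ≤ (1 / 4) ^ 2 := pow_le_pow_left₀ (norm_nonneg _) hz.le 2
    nlinarith
  have hs1 : ‖Complex.sin z‖ ≤ 13 / 50 := by
    have e : Complex.sin z = (Complex.sin z - (z - z ^ 3 / 6)) + (z - z ^ 3 / 6) := by ring
    rw [e]
    refine (norm_add_le _ _).trans ?_
    have h3 : ‖z - z ^ 3 / 6‖ ≤ ‖z‖ + ‖z‖ ^ 3 / 6 := by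
      refine (norm_sub_le _ _).trans ?_
      rw [norm_div, norm_pow, Complex.norm_ofNat]
    have hz5 : ‖z‖ ^ 5 ≤ (1 / 4) ^ 5 := pow_le_pow_left₀ (norm_nonneg _) hz.le 5
    have hz3 : ‖z‖ ^ 3 ≤ (1 / 4) ^ 3 := pow_le_pow_left₀ (norm_nonneg _) hz.le 3
    nlinarith
  have e : etaCheckOf U z =
      ((1 + u0 U : ℝ) : ℂ) / 2 + ((u0 U : ℂ) * (Complex.cos z - 1) + (u3 U : ℂ) * Complex.sin z) / 2 := by
    rw [etaCheckOf]; push_cast; ring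
  rw [e]
  refine (norm_add_le _ _).trans_lt ?_
  rw [norm_div, Complex.norm_real, Complex.norm_ofNat, norm_div, Complex.norm_ofNat]
  have h1 : ‖(1 + u0 U : ℝ)‖ < 3 / 2 := by
    rw [Real.norm_eq_abs, abs_lt]; constructor <;> linarith [abs_le.mp hu0]
  have h2 : ‖(u0 U : ℂ) * (Complex.cos z - 1) + (u3 U : ℂ) * Complex.sin z‖ ≤ 1 * (1 / 16) + 1 * (13 / 50) := by
    refine (norm_add_le _ _).trans (add_le_add ?_ ?_)
    · rw [norm_mul, Complex.norm_real, Real.norm_eq_abs]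
      exact mul_le_mul hu0 hc1 (norm_nonneg _) zero_le_one
    · rw [norm_mul, Complex.norm_real, Real.norm_eq_abs]
      exact mul_le_mul hu3 hs1 (norm_nonneg _) zero_le_one
  linarith

/-- Proposition 1 (second case) for the heat kernel on the printed domain `|z| < ¼`, `u₀ < ½`.
[cite: MullerSchiemann1987, Prop. 1 p.264] -/
theorem prop1_heatKernel_check_of_small (γ : ℝ) {U : SU2} {z θ : ℂ} (hz : ‖z‖ < 1 / 4) (hU : u0 U < 1 / 2)
    (hθ : θ ^ 2 = thetaCheckSq U z) : gTildeHK γ U z = hC γ (π - θ) :=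
  prop1_heatKernel_check γ (norm_etaCheckOf_lt_one hz hU) hθ

end OnSU2

end CentralAngle

end MullerSchiemann1987

end Literature.MathematicalPhysics.QuantumFieldTheory
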